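import Mathlib
import HarnessLib
import Literature.Probability.LatticeModels.RandomClusterFKG
import Literature.Probability.LatticeModels.TwoPointSupNormMonotone
import Literature.Probability.LatticeModels.IsingPlusEdwardsSokal
import Literature.Probability.LatticeModels.GKSInequalities
import Literature.Probability.LatticeModels.SharpnessProofs
import Literature.Probability.LatticeModels.MessagerMiracleSole
import Literature.Probability.LatticeModels.CriticalFKIsingBoxCrossingLower
import Literature.Probability.LatticeModels.ThermodynamicLimit
import Summits.CriticalPhenomena.Ising3DConformalLimit.Theses.ArmDressing
import Summits.CriticalPhenomena.Ising3DConformalLimit.Theses.ArmHyperscaling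
import Summits.CriticalPhenomena.Ising3DConformalLimit.Theses.MirrorHoelderCompactness
import Summits.CriticalPhenomena.Ising3DConformalLimit.Theorems.ArmDressingEvenPatternDecouplingMacroCrossingOfHyperscaling

/-!
# Crux `EvenPatternDecoupling` (stmt-CriticalPhenomena-16133), line `registered`: one-arm hyperscaling AT EVERY RATIO
# from the two existing items 15591 (`ArmHyperscaling.OneArmHyperscaling`) and 6150 (`MirrorHoelderCompactness.TwoPointDoubling`)

A kernel-checked dependency between routes (proved in the line skeleton `Cruxes/EvenPatternDecoupling/Lines/birth.lean`,
revision 9, by lead c1; landed here unchanged): one-arm hyperscaling with ANY ratio constant `K` (item 15591) together with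
all-scale axial two-point doubling (item 6150) gives `∀ lam ≥ 1, ∃ κ > 0, ∃ N₀, ∀ N ≥ N₀, κ θ_wired(N)² ≤ G(lam N e₀)` —
the single input [HS] from which the line derives the RSW-type macroscopic crossing non-degeneracy [N]
(`stub_macroCrossingOfHyperscaling`, p160110) and the non-degeneracy of the even pattern given the arms. Mechanism: for
`N ≥ 2K+2` put `n := (N-1)/K`; the wired arm of `Λ_N` is the `+` magnetisation of `Λ_{N-1} ⊇ Λ_{Kn}`, hence `≤` that of
`Λ_{Kn}` (Griffiths antitonicity in the volume); 15591 bounds its square by `C G(2n e₀)`; doubling iterated `lam K` times and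
Messager–Miracle-Solé axis antitonicity bring `G(2n e₀)` up to `G(lam N e₀)`.
-/

namespace Summit.CriticalPhenomena.Ising3DConformalLimit.Theorems.EvenPatternDecoupling

open scoped Topology
open Filter Set Metric
open Literature.Probability.LatticeModels Literature.Barriers.CriticalPhenomena

/-- Iterated doubling along the axis: `κ^j · G(m e₀) ≤ G(2^j m e₀)` for `m ≥ 1`. -/
theorem criticalTwoPoint_doubling_iter {κ : ℝ} (hκ : 0 < κ)
    (hD : ∀ n : ℕ, 1 ≤ n → κ * criticalTwoPoint 3 (Pi.single 0 (n : ℤ)) ≤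
      criticalTwoPoint 3 (Pi.single 0 (2 * (n : ℤ))))
    (j m : ℕ) (hm : 1 ≤ m) :
    κ ^ j * criticalTwoPoint 3 (Pi.single 0 (m : ℤ)) ≤ criticalTwoPoint 3 (Pi.single 0 ((2 ^ j * m : ℕ) : ℤ)) := by
  induction j with
  | zero => simp
  | succ j ih =>
    have h1 : 1 ≤ 2 ^ j * m := Nat.one_le_iff_ne_zero.2 (by positivity)
    have h2 := hD (2 ^ j * m) h1
    have hcast : (2 * ((2 ^ j * m : ℕ) : ℤ)) = ((2 ^ (j + 1) * m : ℕ) : ℤ) := by push_cast; ring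
    rw [hcast] at h2
    calc κ ^ (j + 1) * criticalTwoPoint 3 (Pi.single 0 (m : ℤ))
        = κ * (κ ^ j * criticalTwoPoint 3 (Pi.single 0 (m : ℤ))) := by ring
      _ ≤ κ * criticalTwoPoint 3 (Pi.single 0 ((2 ^ j * m : ℕ) : ℤ)) := mul_le_mul_of_nonneg_left ih hκ.le
      _ ≤ criticalTwoPoint 3 (Pi.single 0 ((2 ^ (j + 1) * m : ℕ) : ℤ)) := h2

/-- Axis antitonicity of the critical two-point function (MMS): `G(a e₀) ≤ G(b e₀)` for `b ≤ a`. -/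
theorem criticalTwoPoint_axis_anti {a b : ℕ} (hba : b ≤ a) :
    criticalTwoPoint 3 (Pi.single 0 (a : ℤ)) ≤ criticalTwoPoint 3 (Pi.single 0 (b : ℤ)) := by
  unfold criticalTwoPoint
  have h := twoPointPlus_add_single_le (messager_miracleSole_holds (d := 3) (β := criticalBeta 3))
    (criticalBeta_nonneg (d := 3)) (Pi.single 0 (b : ℤ)) 0 (by simp) (a - b)
  have heq : (Pi.single 0 (b : ℤ) : Site 3) + Pi.single 0 (((a - b : ℕ)) : ℤ) = Pi.single 0 (a : ℤ) := by
    rw [← Pi.single_add]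
    congr 1
    push_cast [Nat.cast_sub hba]
    ring
  rw [heq] at h
  exact h

/-- **[HS] from the two existing items** (kernel-checked dependency between routes): one-arm hyperscaling
(`ArmHyperscaling.OneArmHyperscaling`, item 15591, any ratio constant `K`) together with all-scale two-point
doubling (`MirrorHoelderCompactness.TwoPointDoubling`, item 6150) gives one-arm hyperscaling at EVERY ratio,
the registered stub `stub_armHyperscalingAllRatios` of this crux: for `N ≥ 2K + 2` put `n := (N-1)/K`; the wired
arm of `Λ_N` is the `+` magnetisation of `Λ_{N-1} ⊇ Λ_{Kn}`, hence `≤` that of `Λ_{Kn}` (Griffiths), whose square is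
`≤ C·G(2n e₀)` (15591); and `G(lam N e₀) ≥ G(2^j 2n e₀) ≥ κ^j G(2n e₀)` (MMS axis antitonicity, doubling iterated
`j := lam K` times, `2^j · 2n ≥ lam N`). -/
-- the header below is the registered stub signature (whitespace-compressed)
theorem armHyperscalingAllRatios_of_items : open Literature.Probability.LatticeModels Literature.Barriers.CriticalPhenomena in Summit.CriticalPhenomena.Ising3DConformalLimit.Theses.ArmHyperscaling.OneArmHyperscaling→Summit.CriticalPhenomena.Ising3DConformalLimit.Theses.MirrorHoelderCompactness.TwoPointDoubling→∀ lam : ℕ, 1 ≤ lam→∃ κ : ℝ, 0 < κ ∧ ∃ N₀ : ℕ, ∀ N : ℕ, N₀ ≤ N→κ * (thetaWiredBox 3 (fkIsingParam (criticalBeta 3)) 2 N) ^ 2 ≤ criticalTwoPoint 3 (Pi.single 0 ((lam * N : ℕ) : ℤ)) := by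
  intro hOA hTD
  obtain ⟨K, hK1, C, hC⟩ := hOA
  obtain ⟨κ, hκ, hD⟩ := hTD
  intro lam hlam
  -- constants
  set C' : ℝ := max C 1 with hC'
  have hC'pos : 0 < C' := lt_of_lt_of_le one_pos (le_max_right _ _)
  set j : ℕ := lam * K with hj
  refine ⟨κ ^ j / C', by positivity, 2 * K + 2, fun N hN => ?_⟩
  have hβ : (0:ℝ) ≤ criticalBeta 3 := criticalBeta_nonneg (d := 3)
  -- the scales
  set n : ℕ := (N - 1) / K with hn
  have hKn_le : K * n ≤ N - 1 := by rw [hn]; exact Nat.mul_div_le (N - 1) K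
  have hKn_ge : N - K ≤ K * n := by
    rw [hn]
    have h := Nat.div_add_mod (N - 1) K
    have hmod : (N - 1) % K < K := Nat.mod_lt _ (by omega)
    omega
  have hn1 : 1 ≤ n := by
    rw [hn]
    exact (Nat.le_div_iff_mul_le (by omega)).2 (by omega)
  -- (1) wired arm ≤ + magnetisation of the smaller box `Λ_{Kn}`
  have hθeq : thetaWiredBox 3 (fkIsingParam (criticalBeta 3)) 2 N =
      isingCorr (zdGraph 3) (box 3 (N - 1)) (criticalBeta 3) 0 .plus {0} := by
    have hN1 : N = (N - 1) + 1 := by omega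
    rw [hN1, thetaWiredBox_succ_eq_isingCorr_plus (by norm_num) hβ (N - 1)]
    simp
  have hθle : thetaWiredBox 3 (fkIsingParam (criticalBeta 3)) 2 N ≤
      isingCorr (zdGraph 3) (box 3 (K * n)) (criticalBeta 3) 0 .plus {0} := by
    rw [hθeq]
    refine isingCorr_plus_le_of_subset (zdGraph 3) hβ le_rfl ?_ (box_mono 3 hKn_le)
    intro x hx
    rw [Finset.mem_singleton] at hx
    subst hx
    simp [mem_box]
    positivity
  have hθ0 : 0 ≤ thetaWiredBox 3 (fkIsingParam (criticalBeta 3)) 2 N := MeasureTheory.measureReal_nonneg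
  have hsq : thetaWiredBox 3 (fkIsingParam (criticalBeta 3)) 2 N ^ 2 ≤
      (isingCorr (zdGraph 3) (box 3 (K * n)) (criticalBeta 3) 0 .plus {0}) ^ 2 :=
    pow_le_pow_left₀ hθ0 hθle 2
  -- (2) 15591 at `n`
  have h15 := hC n hn1
  have hG0 : 0 ≤ criticalTwoPoint 3 (Pi.single 0 (2 * (n : ℤ))) :=
    (criticalTwoPoint_pos_of_three_le (d := 3) le_rfl _).le
  have h15' : (isingCorr (zdGraph 3) (box 3 (K * n)) (criticalBeta 3) 0 .plus {0}) ^ 2 ≤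
      C' * criticalTwoPoint 3 (Pi.single 0 (2 * (n : ℤ))) :=
    h15.trans (mul_le_mul_of_nonneg_right (le_max_left _ _) hG0)
  -- (3) doubling `j` times from `2n`, then axis antitonicity down to `lam N ≤ 2^j (2n)`
  have hdbl := criticalTwoPoint_doubling_iter hκ hD j (2 * n) (by omega)
  have hcast2 : ((2 * n : ℕ) : ℤ) = 2 * (n : ℤ) := by push_cast; ring
  rw [hcast2] at hdbl
  have hpow : lam * K ≤ 2 ^ j := by rw [hj]; exact (Nat.lt_two_pow_self).le
  have hscale : lam * N ≤ 2 ^ j * (2 * n) := by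
    -- `K (2^j · 2n) ≥ lam K · 2 (N - K) ≥ lam K N` for `N ≥ 2K`
    have h1 : lam * K * (2 * (N - K)) ≤ 2 ^ j * (2 * (K * n)) := by
      have := Nat.mul_le_mul hpow (Nat.mul_le_mul_left 2 hKn_ge)
      linarith [this]
    have h2 : lam * K * N ≤ lam * K * (2 * (N - K)) := Nat.mul_le_mul_left _ (by omega)
    have h3 : K * (lam * N) ≤ K * (2 ^ j * (2 * n)) := by
      have := h2.trans h1
      nlinarith [this]
    exact Nat.le_of_mul_le_mul_left h3 (by omega)
  have hanti := criticalTwoPoint_axis_anti hscale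
  -- assemble
  rw [div_mul_eq_mul_div, div_le_iff₀ hC'pos]
  calc κ ^ j * thetaWiredBox 3 (fkIsingParam (criticalBeta 3)) 2 N ^ 2
      ≤ κ ^ j * (C' * criticalTwoPoint 3 (Pi.single 0 (2 * (n : ℤ)))) :=
        mul_le_mul_of_nonneg_left (hsq.trans h15') (by positivity)
    _ = C' * (κ ^ j * criticalTwoPoint 3 (Pi.single 0 (2 * (n : ℤ)))) := by ring
    _ ≤ C' * criticalTwoPoint 3 (Pi.single 0 ((2 ^ j * (2 * n) : ℕ) : ℤ)) :=
        mul_le_mul_of_nonneg_left hdbl hC'pos.le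
    _ ≤ C' * criticalTwoPoint 3 (Pi.single 0 ((lam * N : ℕ) : ℤ)) :=
        mul_le_mul_of_nonneg_left hanti hC'pos.le
    _ = criticalTwoPoint 3 (Pi.single 0 ((lam * N : ℕ) : ℤ)) * C' := by ring


end Summit.CriticalPhenomena.Ising3DConformalLimit.Theorems.EvenPatternDecoupling
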